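/-
Copyright (c) 2026 the pub-hodgecm-mathlib formalisation cell (harness21).  Prover seat hodgecm-mathlib-LH4-p08 (g3), req620 Track A «(D-RAM) FOUR-FRAME» squad
(heir LEAD F0P3a-plan lineage; dealer LH4-plan (g11) WORD #26 (2); MS ROAD A, Stage B₂ brick B56₂-MULT INPUT, FILE G2-A2: the STABILISER-RELATEDNESS CRITERION (P2)∕(P3) for the
type-2 polarisations of the glued frame; mathematics owed by LH4-p09 (g2)).  2026-09-04.
-/
import Summits.HodgeConjecture.HodgeConjecture.Theorems.F0P3cDyRamDiagonalGluedPolarisationStructureTypeTwo  -- FILE G2-A1 (this seat): (P1) `structure_of_polarisation`; brings ★ p856270, ★ p856076 `mem_latticeStabilizer_latt_glued_corner_iff`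
import HarnessLib

/-!
# Crux `H413`, MS ROAD A, STAGE B₂ brick B56₂-MULT, FILE G2-A2: «POLARISATION CLASSES OF THE TYPE-2 GLUED FRAME — THE STABILISER-RELATEDNESS CRITERION»

Cell `hodgecm-mathlib` (D-0151), FLOOR 0, crux item H413 = `stmt-HodgeConjecture-24833`; lane `--supports stmt-HodgeConjecture-24833 --as helper` (count-neutral).  THEOREMS ONLY.
The type-2 multiplicity `polarisationCount σ ϖ 2 M = #(Δ₂(M) ∕ S_F(M))` (★ StrataDefs ED. 3; LH4-p09 (g2) flag 2026-09-04T00:42:58Z, LH4-p10 (g2) 00:58:37Z, dealer WORD #21∕#26,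
LEAD (R-21)) counts the `S_F(M)`-classes (`D ↦ D·u`) of fixed non-degenerate type-2 polarisations `diag D` of `M`.  For the glued type-2 frame `V = (1 0 0; x ϖ^ρ 0; xζ+y″ ϖ^ρζ ϖ^{2ρ+1+s})`
(`|x| = |ζ| = 1`, `|y″| = |ϖ|^s`, `ρ ≥ 1`, `s` even `≥ 2`) over a ramified quadratic datum, THIS FILE proves LH4-p09 (g2)'s owed items (P2)∕(P3) over FILE G2-A1's structure (P1):
* (P2) `v_sub_le_of_exists_stabiliser` — `D′ = D·u` with `u ∈ S_F(latt V)` ⟹ `|D₁∕D₂ − D′₁∕D′₂| ≤ |ϖ|^{ρ+s+1}` (the `e₃`-axis bound (b) of ★ p856076; `D₁∕D₂ − D′₁∕D′₂ = f_{D′} − f_D`).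
* `v_param_identity_le` — the ONE cleared-denominator identity behind condition (c), in free letters, with its bound `≤ |ϖ|^{2ρ+4s+1}`:
  `xζ·δ·f′·E + y″(Nζ+f)(f′E − fE′)` regrouped through `xζ·W + y″·Nx·(Nζ+f) = −x(xζ+y″)·B` (`E = (D₀∕D₂)·f = κ·q − N(B) + f·W`, `δ = f − f′`).
* (P3) `exists_stabiliser_of_v_sub_le` — the converse: `|f_D − f_{D′}| ≤ |ϖ|^{ρ+s+1}` ⟹ `u := D′∕D ∈ S_F(latt V)` ((b) is the hypothesis, (c) is the identity divided by
  `|(D₀∕D₂)(Nζ+f)ff′| = |ϖ|^{3s}`, (a) follows from (b) ∧ (c); `u` is a fixed unit diagonal by (P1)).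
* **`exists_stabiliser_iff_v_sub_le`** ∕ `exists_stabiliser_iff_v_fParam_sub_le` — `(∃ u ∈ S_F(latt V), ∀ i, D′ i = D i·u i) ↔ |D₁∕D₂ − D′₁∕D′₂| ≤ |ϖ|^{ρ+s+1}`: the classes are the
  fibres of `D ↦ f_D mod (F ∩ 𝔭^{ρ+s+1})` on the (R)-coset `f₀ + F ∩ 𝔭^{ρ+s}` — `q` of them for `ρ` even (★ p856297 exhibited two), one for `ρ` odd; the COUNT is FILE G2-B.
HONEST LABEL.  Count-neutral; the census laws stay PROVER TARGETS until the MS assembly lands; `HC_CM` is proved only modulo the 7 printed citations (2 remaining named inputs: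
hLiu418 = `stmt-HodgeConjecture-24832`, h413 = `stmt-HodgeConjecture-24833`) until rung 0 closes.

## References
* [Jacobowitz1962] R. Jacobowitz, *Hermitian forms over local fields*, Amer. J. Math. 84 (1962), §7 (modular lattices, Gram matrices, dual bases).
* [Kottwitz1986BaseChangeUnits] R. Kottwitz, *Base change for unit elements of Hecke algebras*, Compositio Math. 60 (1986), §1 pp. 240–241 (fixed-lattice counting, torus stabilisers).
-/

set_option autoImplicit false

noncomputable section

namespace Summit.HodgeConjecture.HodgeConjecture.Cruxes.H413.F0P3cDyRamDiagonalGluedPolarisationClassesTypeTwo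

open Matrix
open Literature.NumberTheory.Automorphic Literature.NumberTheory.Automorphic.HermitianLattice Literature.NumberTheory.Automorphic.UnitaryGroup
open Literature.NumberTheory.Automorphic.UnitaryLatticeTree
open Summit.HodgeConjecture.HodgeConjecture.Cruxes.H413.F0P3cDyRamDiagonalTorusDefs
open Summit.HodgeConjecture.HodgeConjecture.Cruxes.H413.F0P3cDyRamDiagonalStableLatticeHNF
open Summit.HodgeConjecture.HodgeConjecture.Cruxes.H413.F0P3cDyRamDiagonalGluedTubeCriterion
open Summit.HodgeConjecture.HodgeConjecture.Cruxes.H413.F0P3cDyRamDiagonalGluedTubeCriterionTypeTwo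
open Summit.HodgeConjecture.HodgeConjecture.Cruxes.H413.F0P3cDyRamDiagonalGluedStabiliserIndex
open Summit.HodgeConjecture.HodgeConjecture.Cruxes.H413.F0P3cDyRamDiagonalGluedStabiliserIndexCorner
open Summit.HodgeConjecture.HodgeConjecture.Cruxes.H413.F0P3cDyRamDiagonalGluedPolarisationStructureTypeTwo
open scoped Valued WithZero Matrix MatrixGroups

variable {K : Type*} [Field K] [Valued K ℤᵐ⁰]

/-! ## §2 (P2)  Stabiliser-related polarisations have congruent (R)-parameters -/

/-- **(P2) `D′ = D·u`, `u ∈ S_F(latt V)` ⟹ `|D₁∕D₂ − D′₁∕D′₂| ≤ |ϖ|^{ρ+s+1}`**: `D₁∕D₂ − D′₁∕D′₂ = (D₁∕D₂)(u₂ − u₁)∕u₂`, `|D₁∕D₂| = 1`, and every `u` in the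
stabiliser of the glued frame obeys the `e₃`-axis bound (b) `|u₂ − u₁| ≤ |ϖ|^{ρ+s+1}` (★ p856076 `mem_latticeStabilizer_latt_glued_corner_iff` at `e = 1`).
[cite: Kottwitz1986BaseChangeUnits, §1 pp. 240–241] -/
theorem v_sub_le_of_exists_stabiliser {σ : K →+* K} {ϖ : K} (hϖ0 : ϖ ≠ 0) (ρ s : ℕ) {x ζ y'' : K} (hx : Valued.v x = 1) (hζ : Valued.v ζ = 1)
    (V : GL (Fin 3) K) (hV : (V : Matrix (Fin 3) (Fin 3) K) = !![1, 0, 0; x, ϖ ^ ρ, 0; x * ζ + y'', ϖ ^ ρ * ζ, ϖ ^ (2 * ρ + 1 + s)])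
    {D D' : Fin 3 → K} (hD2 : D 2 ≠ 0) (hvD1 : Valued.v (D 1) = Valued.v (D 2))
    (h : ∃ u ∈ fixedUnitStabilizer σ (latt (V : Matrix (Fin 3) (Fin 3) K)), ∀ i, D' i = D i * ((u i : Kˣ) : K)) :
    Valued.v (D 1 / D 2 - D' 1 / D' 2) ≤ Valued.v ϖ ^ (ρ + s + 1) := by
  obtain ⟨u, hu, hDu⟩ := h
  rw [mem_fixedUnitStabilizer_iff] at hu
  obtain ⟨hstab, hunit, -⟩ := hu
  have hV1 : (V : Matrix (Fin 3) (Fin 3) K) = !![1, 0, 0; x, ϖ ^ ρ, 0; x * ζ + y'', ϖ ^ ρ * ζ, ϖ ^ (2 * ρ + s + 1)] := by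
    rw [hV, show 2 * ρ + 1 + s = 2 * ρ + s + 1 by ring]
  obtain ⟨-, hb, -⟩ := (mem_latticeStabilizer_latt_glued_corner_iff hϖ0 ρ s 1 hx hζ V hV1 u hunit).1 ((mem_latticeStabilizer_iff _ _).2 hstab)
  have hu2 : ((u 2 : Kˣ) : K) ≠ 0 := (u 2).ne_zero
  have e : D 1 / D 2 - D' 1 / D' 2 = D 1 / D 2 * (((u 2 : Kˣ) : K) - u 1) / u 2 := by
    rw [hDu 1, hDu 2]; field_simp
  rw [e, map_div₀, map_mul, map_div₀, hvD1, div_self ((Valuation.ne_zero_iff _).2 hD2), one_mul, hunit 2, div_one]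
  exact hb

/-! ## §3 (P3)  Congruent (R)-parameters ⟹ stabiliser-related -/

/-- **THE CLEARED-DENOMINATOR IDENTITY BEHIND (c), WITH ITS BOUND** (pure valuation algebra in free letters: `X = σx`, `Z = σζ`, `w = y″`, `Y = σy″`, `q = D₂⁻¹`, `k` the cofactor
quantity of (P1f), `B = ζY − Xf`, `σB = Zw − xf`, `W = xX(ζZ+f) − (xζ+w)(XZ+Y)`, `E = kq − Bσ̄B + fW = (D₀∕D₂)·f`, primes for the second polarisation, `δ = f − f′`):
`xζ·δ·f′·E + w(ζZ+f)(f′E − fE′) = xζδf′(kq − BσB) − δff′x(xζ+w)B + w(ζZ+f)(f′kq − fk′q′) + w(ζZ+f)δ(BσB + f(xB + XσB) + f·xX·δ)` — the `W`-terms regroup through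
`xζ·W + w·xX(ζZ+f) = −x(xζ+w)·B` — and every monomial on the right is `≤ |ϖ|^{2ρ+4s+1}` under the (P1) bounds. [cite: Kottwitz1986BaseChangeUnits, §1 pp. 240–241] -/
theorem v_param_identity_le {ϖ : K} (hϖ1 : Valued.v ϖ ≤ 1) (ρ s : ℕ) {x X ζ Z w Y f f' q q' k k' : K}
    (hx : Valued.v x ≤ 1) (hX : Valued.v X ≤ 1) (hζ : Valued.v ζ ≤ 1) (hZ : Valued.v Z ≤ 1) (hw : Valued.v w ≤ Valued.v ϖ ^ s)
    (hf : Valued.v f ≤ Valued.v ϖ ^ s) (hf' : Valued.v f' ≤ Valued.v ϖ ^ s) (hq : Valued.v q ≤ Valued.v ϖ ^ (2 * ρ + s)) (hq' : Valued.v q' ≤ Valued.v ϖ ^ (2 * ρ + s))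
    (hk : Valued.v k ≤ Valued.v ϖ ^ (s + 1)) (hk' : Valued.v k' ≤ Valued.v ϖ ^ (s + 1)) (hδ : Valued.v (f - f') ≤ Valued.v ϖ ^ (ρ + s + 1))
    (hB : Valued.v (ζ * Y - X * f) ≤ Valued.v ϖ ^ (ρ + s)) (hBc : Valued.v (Z * w - x * f) ≤ Valued.v ϖ ^ (ρ + s)) :
    Valued.v (x * ζ * (f - f') * f' * (k * q - (ζ * Y - X * f) * (Z * w - x * f) + f * (x * X * (ζ * Z + f) - (x * ζ + w) * (X * Z + Y))) +
        w * (ζ * Z + f) * (f' * (k * q - (ζ * Y - X * f) * (Z * w - x * f) + f * (x * X * (ζ * Z + f) - (x * ζ + w) * (X * Z + Y))) -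
          f * (k' * q' - (ζ * Y - X * f') * (Z * w - x * f') + f' * (x * X * (ζ * Z + f') - (x * ζ + w) * (X * Z + Y))))) ≤
      Valued.v ϖ ^ (2 * ρ + 4 * s + 1) := by
  -- the regrouped right-hand side
  have hid : x * ζ * (f - f') * f' * (k * q - (ζ * Y - X * f) * (Z * w - x * f) + f * (x * X * (ζ * Z + f) - (x * ζ + w) * (X * Z + Y))) +
        w * (ζ * Z + f) * (f' * (k * q - (ζ * Y - X * f) * (Z * w - x * f) + f * (x * X * (ζ * Z + f) - (x * ζ + w) * (X * Z + Y))) -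
          f * (k' * q' - (ζ * Y - X * f') * (Z * w - x * f') + f' * (x * X * (ζ * Z + f') - (x * ζ + w) * (X * Z + Y)))) =
      x * ζ * (f - f') * f' * (k * q - (ζ * Y - X * f) * (Z * w - x * f)) +
        -((f - f') * f * f' * x * (x * ζ + w) * (ζ * Y - X * f)) +
        w * (ζ * Z + f) * (f' * k * q - f * k' * q') +
        w * (ζ * Z + f) * (f - f') * ((ζ * Y - X * f) * (Z * w - x * f) + f * (x * (ζ * Y - X * f) + X * (Z * w - x * f)) + f * x * X * (f - f')) := by
    ring
  rw [hid]
  -- bookkeeping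
  have hpow : ∀ {m n : ℕ}, n ≤ m → Valued.v ϖ ^ m ≤ Valued.v ϖ ^ n := fun h => pow_le_pow_right_of_le_one' hϖ1 h
  have hmul : ∀ {a b : K} {m n : ℕ}, Valued.v a ≤ Valued.v ϖ ^ m → Valued.v b ≤ Valued.v ϖ ^ n → Valued.v (a * b) ≤ Valued.v ϖ ^ (m + n) :=
    fun ha hb => by rw [map_mul, pow_add]; exact mul_le_mul' ha hb
  have hadd : ∀ {a b : K} {n : ℕ}, Valued.v a ≤ Valued.v ϖ ^ n → Valued.v b ≤ Valued.v ϖ ^ n → Valued.v (a + b) ≤ Valued.v ϖ ^ n :=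
    fun ha hb => (Valuation.map_add _ _ _).trans (max_le ha hb)
  have hsub : ∀ {a b : K} {n : ℕ}, Valued.v a ≤ Valued.v ϖ ^ n → Valued.v b ≤ Valued.v ϖ ^ n → Valued.v (a - b) ≤ Valued.v ϖ ^ n :=
    fun ha hb => (Valuation.map_sub _ _ _).trans (max_le ha hb)
  have h0 : ∀ {a : K}, Valued.v a ≤ 1 → Valued.v a ≤ Valued.v ϖ ^ 0 := fun ha => by rwa [pow_zero]
  have hx0 := h0 hx; have hX0 := h0 hX; have hζ0 := h0 hζ; have hZ0 := h0 hZ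
  have hy0 : Valued.v (x * ζ + w) ≤ Valued.v ϖ ^ 0 :=
    h0 ((Valuation.map_add _ _ _).trans (max_le (by rw [map_mul]; exact mul_le_one' hx hζ) (hw.trans (pow_le_one₀ zero_le hϖ1))))
  have hNf0 : Valued.v (ζ * Z + f) ≤ Valued.v ϖ ^ 0 :=
    h0 ((Valuation.map_add _ _ _).trans (max_le (by rw [map_mul]; exact mul_le_one' hζ hZ) (hf.trans (pow_le_one₀ zero_le hϖ1))))
  -- term by term
  have hBB : Valued.v ((ζ * Y - X * f) * (Z * w - x * f)) ≤ Valued.v ϖ ^ (ρ + s + (ρ + s)) := hmul hB hBc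
  have t1a : Valued.v (k * q - (ζ * Y - X * f) * (Z * w - x * f)) ≤ Valued.v ϖ ^ (2 * ρ + 2 * s) :=
    hsub ((hmul hk hq).trans (hpow (by omega))) (hBB.trans (hpow (by omega)))
  have t1 : Valued.v (x * ζ * (f - f') * f' * (k * q - (ζ * Y - X * f) * (Z * w - x * f))) ≤ Valued.v ϖ ^ (2 * ρ + 4 * s + 1) :=
    (hmul (hmul (hmul (hmul hx0 hζ0) hδ) hf') t1a).trans (hpow (by omega))
  have t2 : Valued.v (-((f - f') * f * f' * x * (x * ζ + w) * (ζ * Y - X * f))) ≤ Valued.v ϖ ^ (2 * ρ + 4 * s + 1) := by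
    rw [Valuation.map_neg]
    exact (hmul (hmul (hmul (hmul (hmul hδ hf) hf') hx0) hy0) hB).trans (hpow (by omega))
  have t3 : Valued.v (w * (ζ * Z + f) * (f' * k * q - f * k' * q')) ≤ Valued.v ϖ ^ (2 * ρ + 4 * s + 1) :=
    (hmul (hmul hw hNf0) (hsub (hmul (hmul hf' hk) hq) (hmul (hmul hf hk') hq'))).trans (hpow (by omega))
  have t4a : Valued.v ((ζ * Y - X * f) * (Z * w - x * f) + f * (x * (ζ * Y - X * f) + X * (Z * w - x * f)) + f * x * X * (f - f')) ≤ Valued.v ϖ ^ (ρ + 2 * s) :=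
    hadd (hadd (hBB.trans (hpow (by omega))) ((hmul hf (hadd (hmul hx0 hB) (hmul hX0 hBc))).trans (hpow (by omega))))
      ((hmul (hmul (hmul hf hx0) hX0) hδ).trans (hpow (by omega)))
  have t4 : Valued.v (w * (ζ * Z + f) * (f - f') *
      ((ζ * Y - X * f) * (Z * w - x * f) + f * (x * (ζ * Y - X * f) + X * (Z * w - x * f)) + f * x * X * (f - f'))) ≤ Valued.v ϖ ^ (2 * ρ + 4 * s + 1) :=
    (hmul (hmul (hmul hw hNf0) hδ) t4a).trans (hpow (by omega))
  exact hadd (hadd (hadd t1 t2) t3) t4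

/-- **(P3) CONGRUENT (R)-PARAMETERS ⟹ STABILISER-RELATED**: two fixed non-degenerate type-2 polarisations `D, D′` of the glued frame with `|D₁∕D₂ − D′₁∕D′₂| ≤ |ϖ|^{ρ+s+1}`
differ by `u := D′∕D ∈ S_F(latt V)`: `u` is a fixed unit diagonal by (P1) (`|D′ᵢ| = |Dᵢ|`), and of the three stabiliser conditions of ★ p856076 (b) `|u₂ − u₁| = |f_D − f_{D′}|` is the
hypothesis, (c) is `v_param_identity_le` divided by `|(D₀∕D₂)·(Nζ+f)·f·f′| = |ϖ|^{3s}`, and (a) follows from (b) ∧ (c). [cite: Kottwitz1986BaseChangeUnits, §1 pp. 240–241] [cite: Jacobowitz1962, §7] -/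
theorem exists_stabiliser_of_v_sub_le {σ : K →+* K} (hσ : ∀ a, σ (σ a) = a) (hvσ : ∀ a, Valued.v (σ a) = Valued.v a)
    (hfix : ∀ x : K, σ x = x → x ≠ 0 → ∃ n : ℤ, Valued.v x = WithZero.exp (2 * n)) {ϖ : K} (hϖ : Valued.v ϖ = WithZero.exp (-1 : ℤ))
    {ρ : ℕ} (hρ : 1 ≤ ρ) (s : ℕ) (hs2 : 2 ∣ s) (hs : 1 ≤ s) {x ζ y'' : K} (hx : Valued.v x = 1) (hζ : Valued.v ζ = 1) (hy'' : Valued.v y'' = Valued.v ϖ ^ s)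
    (V : GL (Fin 3) K) (hV : (V : Matrix (Fin 3) (Fin 3) K) = !![1, 0, 0; x, ϖ ^ ρ, 0; x * ζ + y'', ϖ ^ ρ * ζ, ϖ ^ (2 * ρ + 1 + s)])
    {D D' : Fin 3 → K} (hD : ∀ i, σ (D i) = D i ∧ D i ≠ 0) (hvert : IsVertexLattice σ ϖ (Matrix.diagonal D) 2 (latt (V : Matrix (Fin 3) (Fin 3) K)))
    (hD' : ∀ i, σ (D' i) = D' i ∧ D' i ≠ 0) (hvert' : IsVertexLattice σ ϖ (Matrix.diagonal D') 2 (latt (V : Matrix (Fin 3) (Fin 3) K)))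
    (hle : Valued.v (D 1 / D 2 - D' 1 / D' 2) ≤ Valued.v ϖ ^ (ρ + s + 1)) :
    ∃ u ∈ fixedUnitStabilizer σ (latt (V : Matrix (Fin 3) (Fin 3) K)), ∀ i, D' i = D i * ((u i : Kˣ) : K) := by
  obtain ⟨hϖ0, hϖ1⟩ := ne_zero_and_v_lt_one_of_v_eq_exp hϖ
  have hvϖ : 0 < Valued.v ϖ := (Valuation.pos_iff _).2 hϖ0
  -- (P1) for both polarisations
  obtain ⟨⟨hf, hR, hvf⟩, ⟨hD1, hvNf⟩, ⟨hvD2, hvD1, hvD0⟩, hk⟩ := structure_of_polarisation hσ hvσ hfix hϖ hρ s hs2 hs hx hζ hy'' V hV hD hvert rfl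
  obtain ⟨⟨hf', hR', hvf'⟩, ⟨hD1', hvNf'⟩, ⟨hvD2', hvD1', hvD0'⟩, hk'⟩ := structure_of_polarisation hσ hvσ hfix hϖ hρ s hs2 hs hx hζ hy'' V hV hD' hvert' rfl
  set f : K := -(D 1 + D 2 * (ζ * σ ζ)) / D 2 with hfdef
  set f' : K := -(D' 1 + D' 2 * (ζ * σ ζ)) / D' 2 with hf'def
  have hD2 : D 2 ≠ 0 := (hD 2).2
  have hD2' : D' 2 ≠ 0 := (hD' 2).2
  have hD0 : D 0 ≠ 0 := (hD 0).2
  have hNf : ζ * σ ζ + f ≠ 0 := fun h => by rw [h, map_zero] at hvNf; exact zero_ne_one hvNf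
  have hf0 : f ≠ 0 := fun h => by rw [h, map_zero] at hvf; exact pow_ne_zero _ hvϖ.ne' hvf.symm
  have hf0' : f' ≠ 0 := fun h => by rw [h, map_zero] at hvf'; exact pow_ne_zero _ hvϖ.ne' hvf'.symm
  -- `|f − f'| ≤ |ϖ|^{ρ+s+1}`
  have hδ : Valued.v (f - f') ≤ Valued.v ϖ ^ (ρ + s + 1) := by
    have e : f - f' = -(D 1 / D 2 - D' 1 / D' 2) := by rw [hD1, hD1']; field_simp; ring
    rw [e, Valuation.map_neg]; exact hle
  -- the quotient `u = D'∕D`: fixed units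
  have hvq : ∀ i, Valued.v (D' i / D i) = 1 := by
    intro i
    rw [map_div₀, div_eq_one_iff_eq ((Valuation.ne_zero_iff _).2 (hD i).2)]
    fin_cases i
    · exact hvD0'.trans hvD0.symm
    · exact (hvD1'.trans (hvD2'.trans hvD2.symm)).trans hvD1.symm
    · exact hvD2'.trans hvD2.symm
  set u : Fin 3 → Kˣ := fun i => Units.mk0 (D' i / D i) (div_ne_zero (hD' i).2 (hD i).2) with hudef
  have hu : ∀ i, ((u i : Kˣ) : K) = D' i / D i := fun i => rfl
  have hDu : ∀ i, D' i = D i * ((u i : Kˣ) : K) := fun i => by rw [hu]; field_simp [(hD i).2]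
  have hunit : ∀ i, Valued.v ((u i : Kˣ) : K) = 1 := fun i => by rw [hu]; exact hvq i
  have hfixu : ∀ i, σ ((u i : Kˣ) : K) = u i := fun i => by rw [hu, map_div₀, (hD i).1, (hD' i).1]
  refine ⟨u, ?_, hDu⟩
  -- the three stabiliser conditions
  have hV1 : (V : Matrix (Fin 3) (Fin 3) K) = !![1, 0, 0; x, ϖ ^ ρ, 0; x * ζ + y'', ϖ ^ ρ * ζ, ϖ ^ (2 * ρ + s + 1)] := by
    rw [hV, show 2 * ρ + 1 + s = 2 * ρ + s + 1 by ring]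
  -- (b)
  have hb : Valued.v (((u 2 : Kˣ) : K) - u 1) ≤ Valued.v ϖ ^ (ρ + s + 1) := by
    have e : ((u 2 : Kˣ) : K) - u 1 = D' 2 / D 2 * (f - f') / (ζ * σ ζ + f) := by
      rw [hu, hu, hD1, hD1']; field_simp; ring
    rw [e, map_div₀, map_mul, hvq 2, one_mul, hvNf, div_one]
    exact hδ
  -- (c)
  have hc : Valued.v (x * ζ * (((u 2 : Kˣ) : K) - u 1) + y'' * (((u 2 : Kˣ) : K) - u 0)) ≤ Valued.v ϖ ^ (2 * ρ + s + 1) := by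
    -- the cofactor letters
    set k : K := f * (D 0 + σ x * D 1 * x + σ (x * ζ + y'') * D 2 * (x * ζ + y'')) + D 2 * ((ζ * σ y'' - σ x * f) * (σ ζ * y'' - x * f)) with hkdef
    set k' : K := f' * (D' 0 + σ x * D' 1 * x + σ (x * ζ + y'') * D' 2 * (x * ζ + y'')) + D' 2 * ((ζ * σ y'' - σ x * f') * (σ ζ * y'' - x * f')) with hk'def
    have hσy : σ (x * ζ + y'') = σ x * σ ζ + σ y'' := by rw [map_add, map_mul]
    -- `E = (D₀∕D₂)·f`, `E' = (D'₀∕D'₂)·f'`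
    have hE : D 0 / D 2 * f = k * (D 2)⁻¹ - (ζ * σ y'' - σ x * f) * (σ ζ * y'' - x * f) + f * (x * σ x * (ζ * σ ζ + f) - (x * ζ + y'') * (σ x * σ ζ + σ y'')) := by
      rw [hkdef, hσy, hD1]; field_simp; ring
    have hE' : D' 0 / D' 2 * f' = k' * (D' 2)⁻¹ - (ζ * σ y'' - σ x * f') * (σ ζ * y'' - x * f') + f' * (x * σ x * (ζ * σ ζ + f') - (x * ζ + y'') * (σ x * σ ζ + σ y'')) := by
      rw [hk'def, hσy, hD1']; field_simp; ring
    -- the cleared-denominator relation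
    have hT : (x * ζ * (((u 2 : Kˣ) : K) - u 1) + y'' * (((u 2 : Kˣ) : K) - u 0)) * (D 2 / D' 2 * (D 0 / D 2) * (ζ * σ ζ + f) * f * f') =
        x * ζ * (f - f') * f' * (D 0 / D 2 * f) + y'' * (ζ * σ ζ + f) * (f' * (D 0 / D 2 * f) - f * (D' 0 / D' 2 * f')) := by
      rw [hu, hu, hu, hD1, hD1']; field_simp; ring
    have hbound := v_param_identity_le hϖ1.le ρ s (x := x) (X := σ x) (ζ := ζ) (Z := σ ζ) (w := y'') (Y := σ y'') (f := f) (f' := f')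
      (q := (D 2)⁻¹) (q' := (D' 2)⁻¹) (k := k) (k' := k') hx.le (by rw [hvσ, hx]) hζ.le (by rw [hvσ, hζ]) hy''.le hvf.le hvf'.le
      (by rw [map_inv₀, hvD2, inv_inv]) (by rw [map_inv₀, hvD2', inv_inv]) hk hk' hδ hR
      (by rw [← hvσ, map_sub, map_mul, map_mul, hσ, hf]; exact hR)
    rw [← hE, ← hE', ← hT, map_mul] at hbound
    -- divide by `|D₂∕D'₂ · D₀∕D₂ · (Nζ+f) · f · f'| = |ϖ|^{3s}`
    have hden : Valued.v (D 2 / D' 2 * (D 0 / D 2) * (ζ * σ ζ + f) * f * f') = Valued.v ϖ ^ (3 * s) := by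
      have h1 : Valued.v (D 2 / D' 2) = 1 := by rw [map_div₀, hvD2, hvD2', div_self (inv_ne_zero (pow_ne_zero _ hvϖ.ne'))]
      have h2 : Valued.v (D 0 / D 2) = Valued.v ϖ ^ s := by
        rw [map_div₀, hvD0, hvD2, inv_div_inv, div_eq_iff (pow_ne_zero _ hvϖ.ne'), ← pow_add]; congr 1; ring
      rw [map_mul, map_mul, map_mul, map_mul, h1, h2, hvNf, hvf, hvf', one_mul, mul_one, ← pow_add, ← pow_add]; congr 1; ring
    rw [hden] at hbound
    have hsplit : Valued.v ϖ ^ (2 * ρ + 4 * s + 1) = Valued.v ϖ ^ (2 * ρ + s + 1) * Valued.v ϖ ^ (3 * s) := by rw [← pow_add]; congr 1; ring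
    rw [hsplit] at hbound
    exact le_of_mul_le_mul_right hbound (pow_pos hvϖ _)
  -- (a) from (b) and (c)
  have ha : Valued.v (((u 1 : Kˣ) : K) - u 0) ≤ Valued.v ϖ ^ ρ := by
    have h20 : Valued.v (y'' * (((u 2 : Kˣ) : K) - u 0)) ≤ Valued.v ϖ ^ (ρ + s + 1) := by
      have e : y'' * (((u 2 : Kˣ) : K) - u 0) = (x * ζ * (((u 2 : Kˣ) : K) - u 1) + y'' * (((u 2 : Kˣ) : K) - u 0)) - x * ζ * (((u 2 : Kˣ) : K) - u 1) := by ring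
      rw [e]
      refine (Valuation.map_sub _ _ _).trans (max_le (hc.trans (pow_le_pow_right_of_le_one' hϖ1.le (by omega))) ?_)
      rw [map_mul, map_mul, hx, hζ, one_mul, one_mul]; exact hb
    rw [map_mul, hy'', show ρ + s + 1 = s + (ρ + 1) by ring, pow_add] at h20
    have h20' : Valued.v (((u 2 : Kˣ) : K) - u 0) ≤ Valued.v ϖ ^ (ρ + 1) := le_of_mul_le_mul_left h20 (pow_pos hvϖ _)
    have e : ((u 1 : Kˣ) : K) - u 0 = (((u 2 : Kˣ) : K) - u 0) - (((u 2 : Kˣ) : K) - u 1) := by ring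
    rw [e]
    refine (Valuation.map_sub _ _ _).trans (max_le (h20'.trans (pow_le_pow_right_of_le_one' hϖ1.le (by omega)))
      (hb.trans (pow_le_pow_right_of_le_one' hϖ1.le (by omega))))
  rw [mem_fixedUnitStabilizer_iff]
  exact ⟨(mem_latticeStabilizer_iff _ _).1 ((mem_latticeStabilizer_latt_glued_corner_iff hϖ0 ρ s 1 hx hζ V hV1 u hunit).2 ⟨ha, hb, hc⟩), hunit, hfixu⟩

/-! ## §4  The relatedness criterion -/

/-- **THE STABILISER-RELATEDNESS CRITERION (P2) ∧ (P3)** on the type-2 glued frame `V = (1 0 0; x ϖ^ρ 0; xζ+y″ ϖ^ρζ ϖ^{2ρ+1+s})` (`|x| = |ζ| = 1`, `|y″| = |ϖ|^s`, `ρ ≥ 1`,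
`s` even `≥ 2`) over a ramified quadratic datum: two fixed non-degenerate type-2 polarisations `D, D′` of `latt V` lie in the same `S_F(latt V)`-class iff
`|D₁∕D₂ − D′₁∕D′₂| ≤ |ϖ|^{ρ+s+1}` (LH4-p09 (g2)'s (P2)∕(P3); the classes are the fibres of `D ↦ f_D mod F ∩ 𝔭^{ρ+s+1}`). [cite: Kottwitz1986BaseChangeUnits, §1 pp. 240–241] [cite: Jacobowitz1962, §7] -/
theorem exists_stabiliser_iff_v_sub_le {σ : K →+* K} (hσ : ∀ a, σ (σ a) = a) (hvσ : ∀ a, Valued.v (σ a) = Valued.v a)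
    (hfix : ∀ x : K, σ x = x → x ≠ 0 → ∃ n : ℤ, Valued.v x = WithZero.exp (2 * n)) {ϖ : K} (hϖ : Valued.v ϖ = WithZero.exp (-1 : ℤ))
    {ρ : ℕ} (hρ : 1 ≤ ρ) (s : ℕ) (hs2 : 2 ∣ s) (hs : 1 ≤ s) {x ζ y'' : K} (hx : Valued.v x = 1) (hζ : Valued.v ζ = 1) (hy'' : Valued.v y'' = Valued.v ϖ ^ s)
    (V : GL (Fin 3) K) (hV : (V : Matrix (Fin 3) (Fin 3) K) = !![1, 0, 0; x, ϖ ^ ρ, 0; x * ζ + y'', ϖ ^ ρ * ζ, ϖ ^ (2 * ρ + 1 + s)])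
    {D D' : Fin 3 → K} (hD : ∀ i, σ (D i) = D i ∧ D i ≠ 0) (hvert : IsVertexLattice σ ϖ (Matrix.diagonal D) 2 (latt (V : Matrix (Fin 3) (Fin 3) K)))
    (hD' : ∀ i, σ (D' i) = D' i ∧ D' i ≠ 0) (hvert' : IsVertexLattice σ ϖ (Matrix.diagonal D') 2 (latt (V : Matrix (Fin 3) (Fin 3) K))) :
    (∃ u ∈ fixedUnitStabilizer σ (latt (V : Matrix (Fin 3) (Fin 3) K)), ∀ i, D' i = D i * ((u i : Kˣ) : K)) ↔
      Valued.v (D 1 / D 2 - D' 1 / D' 2) ≤ Valued.v ϖ ^ (ρ + s + 1) := by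
  obtain ⟨hϖ0, -⟩ := ne_zero_and_v_lt_one_of_v_eq_exp hϖ
  obtain ⟨-, -, ⟨-, hvD1, -⟩, -⟩ := structure_of_polarisation hσ hvσ hfix hϖ hρ s hs2 hs hx hζ hy'' V hV hD hvert rfl
  exact ⟨v_sub_le_of_exists_stabiliser hϖ0 ρ s hx hζ V hV (hD 2).2 hvD1,
    exists_stabiliser_of_v_sub_le hσ hvσ hfix hϖ hρ s hs2 hs hx hζ hy'' V hV hD hvert hD' hvert'⟩

/-- **THE CRITERION IN (R)-PARAMETER LETTERS**: with `f_D = −(D₁ + D₂Nζ)∕D₂`, `f_{D′}` likewise, `D₁∕D₂ − D′₁∕D′₂ = f_{D′} − f_D`, so the classes are read off the parameters: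
`(∃ u ∈ S_F(latt V), D′ = D·u) ↔ |f_D − f_{D′}| ≤ |ϖ|^{ρ+s+1}`. [cite: Kottwitz1986BaseChangeUnits, §1 pp. 240–241] -/
theorem exists_stabiliser_iff_v_fParam_sub_le {σ : K →+* K} (hσ : ∀ a, σ (σ a) = a) (hvσ : ∀ a, Valued.v (σ a) = Valued.v a)
    (hfix : ∀ x : K, σ x = x → x ≠ 0 → ∃ n : ℤ, Valued.v x = WithZero.exp (2 * n)) {ϖ : K} (hϖ : Valued.v ϖ = WithZero.exp (-1 : ℤ))
    {ρ : ℕ} (hρ : 1 ≤ ρ) (s : ℕ) (hs2 : 2 ∣ s) (hs : 1 ≤ s) {x ζ y'' : K} (hx : Valued.v x = 1) (hζ : Valued.v ζ = 1) (hy'' : Valued.v y'' = Valued.v ϖ ^ s)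
    (V : GL (Fin 3) K) (hV : (V : Matrix (Fin 3) (Fin 3) K) = !![1, 0, 0; x, ϖ ^ ρ, 0; x * ζ + y'', ϖ ^ ρ * ζ, ϖ ^ (2 * ρ + 1 + s)])
    {D D' : Fin 3 → K} (hD : ∀ i, σ (D i) = D i ∧ D i ≠ 0) (hvert : IsVertexLattice σ ϖ (Matrix.diagonal D) 2 (latt (V : Matrix (Fin 3) (Fin 3) K)))
    (hD' : ∀ i, σ (D' i) = D' i ∧ D' i ≠ 0) (hvert' : IsVertexLattice σ ϖ (Matrix.diagonal D') 2 (latt (V : Matrix (Fin 3) (Fin 3) K)))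
    {f f' : K} (hfD : f = -(D 1 + D 2 * (ζ * σ ζ)) / D 2) (hfD' : f' = -(D' 1 + D' 2 * (ζ * σ ζ)) / D' 2) :
    (∃ u ∈ fixedUnitStabilizer σ (latt (V : Matrix (Fin 3) (Fin 3) K)), ∀ i, D' i = D i * ((u i : Kˣ) : K)) ↔
      Valued.v (f - f') ≤ Valued.v ϖ ^ (ρ + s + 1) := by
  have e : f - f' = -(D 1 / D 2 - D' 1 / D' 2) := by
    rw [hfD, hfD']; field_simp [(hD 2).2, (hD' 2).2]; ring
  rw [exists_stabiliser_iff_v_sub_le hσ hvσ hfix hϖ hρ s hs2 hs hx hζ hy'' V hV hD hvert hD' hvert', e, Valuation.map_neg]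

end Summit.HodgeConjecture.HodgeConjecture.Cruxes.H413.F0P3cDyRamDiagonalGluedPolarisationClassesTypeTwo

end
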